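import Summits.Ventures.LatticeQCDFlow.Scaling.TwoLevelRegimeFreeDoeblin
import Literature.Probability.MarkovChains.DoeblinCesaroAverages

/-!
HONEST FRAMING: exact (Metropolis-corrected) sampling algorithms for lattice gauge theory; figures
of merit are autocorrelation/cost numbers at stated couplings and volumes; no continuum-physics
claim.

# DominatedStarVolumeFreeDoeblin — FOR EVERY NUMBER `K` OF COLD LEVELS, EXACT HOT REDRAWS AND PER-ENTRY MAPS WITH ONE-SIDED DOMINATION:
# `P^{2K+1}(x,·) ≥ (1−t)w_0·(t·p·(1−t)w_0/m)^K · π̃(·)` FOR EVERY START — A COLD-START TOTAL-VARIATION LAW FREE OF THE VOLUME AND OF THE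
# REGIME (RATE EXPONENTIALLY SMALL IN `K`: QUALITATIVE) (lean-2 GEN-28, ours)

Venture-side (OURS).  Cell `lqcd-flow` (pub-lqcd), unit `pub-lqcd-lean-2-g28`, 2026-08-28.  Chapter N, file 19: the pattern of
`Scaling/TwoLevelRegimeFreeDoeblin` (N18) run through the whole star.  Scheme `P = t·GSw + (1−t)·Π_w` on `S^{Fin (K+1)}`, hub edges `(0,k)`
each listed at least once among the `m` entries (`κ` onto), entry maps `φ_r` with `p·μ_k(φ_r u) ≤ μ_0(u)`, exact hot redraws, `μ_k`-reversible
kernels, `0 ≤ t ≤ 1`, `w ≥ 0`, `Σw = 1`.  By induction on `j ≤ K`: `P^{2j+1}(x,y) ≥ δ_j·μ_0(y_0)·Π_{k<j}μ_{k+1}(y_{k+1})` for every `y` agreeing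
with `x` at the levels `> j`, `δ_0 = (1−t)w_0`, `δ_{j+1} = δ_j·(t/m)·p·(1−t)w_0` — the step is REDRAW–…–SWAP_{j+1}–REDRAW: the path through
`a = y^{0←φ_r⁻¹y_{j+1}, (j+1)←x_{j+1}}` and its swap `b = y^{0←φ_r⁻¹x_{j+1}}`, with the Metropolis weight bounded below by domination at the
target AND at the current content of level `j+1` (N18's computation, the other levels' factors cancelling).  At `j = K`: the Doeblin
condition `P^{2K+1} ≥ δ_K·π̃`, hence `d(n) ≤ (1 − δ_K)^{⌊n/(2K+1)⌋}` and `t_mix(ε) ≤ (2K+1)·⌈log(1/ε)/δ_K⌉`.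

## What is proved

* **`dominatedStar_pow_pattern_ge`** — the induction (`j ≤ K`).
* **`dominatedStar_pow_ge_tensorFun`** — `P^{2K+1}(x,y) ≥ (1−t)w_0·(t·p·(1−t)w_0/m)^K·π̃(y)`; **`dominatedStar_doeblinCondition`**.
* **`dominatedStar_worstTvDist_le_volumeFree`** — `d(n) ≤ (1 − (1−t)w_0(tp(1−t)w_0/m)^K)^{⌊n/(2K+1)⌋}`;
  **`dominatedStar_mixingTime_le_volumeFree`** — `t_mix(ε) ≤ (2K+1)·⌈log(1/ε)/((1−t)w_0(tp(1−t)w_0/m)^K)⌉`.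

Reading (no numerics implied): QUALITATIVE.  For every fixed ladder size `K`, swap fraction and map quality, the cold-start mixing time of
the map-assisted star with exact hot redraws is bounded UNIFORMLY IN THE LATTICE VOLUME with no regime condition — so the volume logarithm
`log(1/π̃_min)` of `Scaling/DominatedStarRegimeFreeRelaxation` (N4) is an artefact of the `ℓ²` route for every `K`, not only for `K = 1`.  The
rate `δ_K/(2K+1)` is exponentially small in `K` (`m ≥ K`), against the conjectured `Θ(G) = Θ(p·min{t, (1−t)w_0}/K)`: OPEN-MATH-chapterM
item 1 (a law polynomial in `K`) stays open for `K ≥ 2`.  NOT CLAIMED: any quantitative merit of `δ_K`; anything measured.  Literature grade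
(cell rule): OWN RESULT on the tree's Doeblin theorem [Saloffcoste1997, Thm 1.2.7]; nothing new cited as a fact; no new bib keys.
-/

noncomputable section

open Finset Function Matrix
open Literature.Probability.MarkovChains

namespace Summit.Ventures.LatticeQCDFlow.Scaling

variable {S : Type*} [Fintype S] [DecidableEq S] {K m : ℕ} {μ : Fin (K + 1) → S → ℝ} {M : Fin (K + 1) → S → S → ℝ}
  {w : Fin (K + 1) → ℝ} {t p : ℝ}

omit [Fintype S] [DecidableEq S] in
/-- The partial product `Π_{k<j} μ_{k+1}(y_{k+1})` over the first `j` cold levels gains one factor. -/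
theorem partProd_succ (μ : Fin (K + 1) → S → ℝ) (y : Fin (K + 1) → S) {j : ℕ} (hj : j < K) :
    (∏ k : Fin K, (if k.val < j + 1 then μ k.succ (y k.succ) else 1))
      = (∏ k : Fin K, (if k.val < j then μ k.succ (y k.succ) else 1)) * μ (⟨j, hj⟩ : Fin K).succ (y (⟨j, hj⟩ : Fin K).succ) := by
  have hsplit : ∀ k : Fin K, (if k.val < j + 1 then μ k.succ (y k.succ) else 1)
      = (if k.val < j then μ k.succ (y k.succ) else 1) * (if k = ⟨j, hj⟩ then μ k.succ (y k.succ) else 1) := by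
    intro k
    by_cases h1 : k.val < j
    · have hne : k ≠ ⟨j, hj⟩ := fun h => by rw [h] at h1; exact lt_irrefl _ h1
      rw [if_pos (by omega), if_pos h1, if_neg hne, mul_one]
    · by_cases h2 : k = ⟨j, hj⟩
      · rw [if_pos (by rw [h2]; exact Nat.lt_succ_self j), if_neg h1, if_pos h2, one_mul]
      · have h3 : ¬ k.val < j + 1 := fun h => by
          have : k.val = j := by
            have hkj : k.val ≠ j := fun h' => h2 (Fin.ext h')
            omega
          exact h2 (Fin.ext this)
        rw [if_neg h3, if_neg h1, if_neg h2, mul_one]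
  rw [prod_congr rfl fun k _ => hsplit k, prod_mul_distrib, prod_ite_eq' univ (⟨j, hj⟩ : Fin K), if_pos (mem_univ _)]

section Star
variable (κ : Fin m → Fin K) (φ : Fin m → Equiv.Perm S)

/-- **THE PATTERN INDUCTION:** for `j ≤ K` and every `y` agreeing with `x` at the levels `> j`,
`P^{2j+1}(x,y) ≥ (1−t)w_0·((t/m)·p·(1−t)w_0)^j · μ_0(y_0)·Π_{k<j}μ_{k+1}(y_{k+1})` (exact hot redraws, `κ` onto, one-sided domination,
`0 ≤ t ≤ 1`, `0 ≤ p`, `w ≥ 0`, `Σw = 1`). [ours] -/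
theorem dominatedStar_pow_pattern_ge (hm : 1 ≤ m) (hμ : ∀ k x, 0 < μ k x) (hM : ∀ k, IsRowStochastic (M k))
    (hM0 : ∀ u v, M 0 u v = μ 0 v) (hw0 : ∀ k, 0 ≤ w k) (hw1 : ∑ k, w k = 1) (ht0 : 0 ≤ t) (ht1 : t ≤ 1) (hp : 0 ≤ p)
    (hdom : ∀ r u, p * μ (κ r).succ (φ r u) ≤ μ 0 u) (hsurj : ∀ k : Fin K, ∃ r, κ r = k) :
    ∀ j : ℕ, j ≤ K → ∀ x y : Fin (K + 1) → S, (∀ k : Fin K, j ≤ k.val → y k.succ = x k.succ) →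
      (1 - t) * w 0 * (t / m * p * ((1 - t) * w 0)) ^ j * (μ 0 (y 0) * ∏ k : Fin K, (if k.val < j then μ k.succ (y k.succ) else 1))
        ≤ ((Matrix.of fun a b : Fin (K + 1) → S =>
            t * ptGraphSwap μ (fun r : Fin m => (((0 : Fin (K + 1)), (κ r).succ) : Fin (K + 1) × Fin (K + 1))) φ a b
              + (1 - t) * prodKernel w M a b) ^ (2 * j + 1)) x y := by
  have hmpos : (0 : ℝ) < m := Nat.cast_pos.mpr (by omega)
  have hπ := tensorFun_pos hμ
  have h1t : 0 ≤ 1 - t := by linarith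
  have hh : 0 ≤ (1 - t) * w 0 := mul_nonneg h1t (hw0 0)
  set e : Fin m → Fin (K + 1) × Fin (K + 1) := fun r => (((0 : Fin (K + 1)), (κ r).succ) : Fin (K + 1) × Fin (K + 1)) with he_def
  have he : ∀ r, (e r).1 ≠ (e r).2 := fun r => (Fin.succ_ne_zero (κ r)).symm
  set P : (Fin (K + 1) → S) → (Fin (K + 1) → S) → ℝ := fun a b =>
    t * ptGraphSwap μ e φ a b + (1 - t) * prodKernel w M a b with hPdef
  have hPst : IsRowStochastic P := weightedScheme_isRowStochastic (ptGraphSwap_isRowStochastic hμ) hM hw0 hw1 ht0 ht1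
  have hP0 : ∀ a b, 0 ≤ P a b := hPst.1
  have hPup : ∀ (a : Fin (K + 1) → S) (v : S), (1 - t) * w 0 * μ 0 v ≤ P a (update a 0 v) := fun a v =>
    exchangeScheme_apply_update_zero_ge e φ hμ hM hM0 hw0 ht0 ht1 a v
  -- the entry kernels and `P ≥ (t/m)·Met_r`
  set Met : Fin m → (Fin (K + 1) → S) → (Fin (K + 1) → S) → ℝ := fun r =>
    mhKernel (fun a b : Fin (K + 1) → S => if b = edgeFlowSwap (φ r) (e r).1 (e r).2 a then (1 : ℝ) else 0) (tensorFun μ)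
    with hMet
  have hMet0 : ∀ r a b, 0 ≤ Met r a b := fun r a b =>
    mhKernel_nonneg (entryProposal_basic (φ := φ) he r).1 (entryProposal_basic (φ := φ) he r).2.1 hπ a b
  have hPMet : ∀ r a b, t / m * Met r a b ≤ P a b := by
    intro r a b
    have h1 : t * ptGraphSwap μ e φ a b ≤ P a b := exchangeScheme_apply_ge_swap e φ hM hw0 ht1 a b
    have h2 : (1 : ℝ) / m * Met r a b ≤ ptGraphSwap μ e φ a b := by
      rw [ptGraphSwap_eq_avg_entryKernel hm he hμ a b]
      exact single_le_sum (f := fun s => (1 : ℝ) / m * Met s a b) (fun s _ => mul_nonneg (by positivity) (hMet0 s a b))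
        (mem_univ r)
    calc t / m * Met r a b = t * ((1 : ℝ) / m * Met r a b) := by ring
      _ ≤ t * ptGraphSwap μ e φ a b := mul_le_mul_of_nonneg_left h2 ht0
      _ ≤ P a b := h1
  -- powers of `P` are non-negative
  have hpow0 : ∀ (n : ℕ) (a b : Fin (K + 1) → S), 0 ≤ ((Matrix.of P) ^ n) a b := fun n a b =>
    (IsRowStochastic.matPow (P := Matrix.of P) hPst n).1 a b
  intro j
  induction j with
  | zero =>
    intro _ x y hagree
    -- `y = x^{0←y_0}` and `P(x,y) ≥ (1−t)w_0·μ_0(y_0)`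
    have hy : y = update x 0 (y 0) := by
      funext i
      cases i using Fin.cases with
      | zero => rw [update_self]
      | succ k => rw [update_of_ne (Fin.succ_ne_zero k), hagree k (Nat.zero_le _)]
    have hprod : (∏ k : Fin K, (if k.val < 0 then μ k.succ (y k.succ) else 1)) = 1 :=
      prod_eq_one fun k _ => if_neg (Nat.not_lt_zero _)
    rw [hprod, pow_zero, mul_one, mul_one, Nat.mul_zero, Nat.zero_add, pow_one, Matrix.of_apply]
    have h := hPup x (y 0)
    rw [← hy] at h
    exact h
  | succ j ih =>
    intro hjK x y hagree
    have hjlt : j < K := by omega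
    set l : Fin (K + 1) := (⟨j, hjlt⟩ : Fin K).succ with hl
    have hl0 : l ≠ 0 := Fin.succ_ne_zero _
    obtain ⟨r, hr⟩ := hsurj ⟨j, hjlt⟩
    have her : e r = ((0 : Fin (K + 1)), l) := by simp only [he_def, hr, hl]
    -- the path
    set ξ : S := (φ r).symm (y l) with hξ
    set η : S := (φ r).symm (x l) with hη
    set a₀ : Fin (K + 1) → S := update (update y 0 ξ) l (x l) with ha₀
    set b₀ : Fin (K + 1) → S := update y 0 η with hb₀
    have ha0 : a₀ 0 = ξ := by rw [ha₀, update_of_ne hl0.symm, update_self]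
    have hal : a₀ l = x l := by rw [ha₀, update_self]
    have haother : ∀ i, i ≠ 0 → i ≠ l → a₀ i = y i := fun i hi0 hil => by
      rw [ha₀, update_of_ne hil, update_of_ne hi0]
    have hswap : edgeFlowSwap (φ r) (e r).1 (e r).2 a₀ = b₀ := by
      rw [her]
      funext i
      by_cases hi0 : i = 0
      · rw [hi0, edgeFlowSwap_fst (φ r) hl0.symm, hal, hb₀, update_self]
      · by_cases hil : i = l
        · rw [hil, edgeFlowSwap_snd, ha0, hξ, Equiv.apply_symm_apply, hb₀, update_of_ne hl0]
        · rw [edgeFlowSwap_of_ne (φ r) 0 l a₀ hi0 hil, haother i hi0 hil, hb₀, update_of_ne hi0]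
    -- the induction hypothesis at `(x, a₀)`
    have hagree' : ∀ k : Fin K, j ≤ k.val → a₀ k.succ = x k.succ := by
      intro k hk
      by_cases hkj : k.val = j
      · have : k.succ = l := by rw [hl]; exact congrArg Fin.succ (Fin.ext hkj)
        rw [this, hal]
      · have hne : k.succ ≠ l := fun h => hkj (by
          have := Fin.succ_inj.mp (h.trans hl.symm ▸ rfl : k.succ = (⟨j, hjlt⟩ : Fin K).succ)
          exact congrArg Fin.val this)
        rw [haother k.succ (Fin.succ_ne_zero k) hne]
        exact hagree k (by omega)
    have hIH := ih (by omega) x a₀ hagree'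
    have hprod_a : (∏ k : Fin K, (if k.val < j then μ k.succ (a₀ k.succ) else 1))
        = ∏ k : Fin K, (if k.val < j then μ k.succ (y k.succ) else 1) := by
      refine prod_congr rfl fun k _ => ?_
      by_cases hk : k.val < j
      · have hne : k.succ ≠ l := fun h => by
          have : k = ⟨j, hjlt⟩ := Fin.succ_inj.mp (h.trans rfl)
          rw [this] at hk; exact lt_irrefl _ hk
        rw [if_pos hk, if_pos hk, haother k.succ (Fin.succ_ne_zero k) hne]
      · rw [if_neg hk, if_neg hk]
    rw [ha0, hprod_a] at hIH
    -- the swap factor: `μ_0(ξ)·Met_r(a₀,b₀) ≥ p·μ_l(y_l)`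
    have h2 : p * μ l (y l) ≤ μ 0 ξ * Met r a₀ b₀ := by
      have hkey : tensorFun μ a₀ * Met r a₀ b₀ = min (tensorFun μ a₀) (tensorFun μ b₀) := by
        rw [← hswap]; exact detEntryKernel_mul_apply_swap hμ (φ r) (he r) a₀
      -- `π̃(a₀) = μ_0(ξ)·W`, `π̃(b₀)·μ_0(ξ)·μ_l(x_l) = π̃(a₀)·μ_0(η)·μ_l(y_l)`
      set W : ℝ := ∏ i ∈ univ \ {(0 : Fin (K + 1))}, μ i (a₀ i) with hW
      have hWpos : 0 < W := prod_pos fun i _ => hμ i _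
      have ha : tensorFun μ a₀ = μ 0 ξ * W := by rw [tensorFun_eq_mul_prod μ a₀ 0, ha0]
      have hb : tensorFun μ b₀ * (μ 0 ξ * μ l (x l)) = tensorFun μ a₀ * (μ 0 η * μ l (y l)) := by
        have h := tensorFun_edgeFlowSwap_mul μ (φ r) hl0.symm a₀
        have hswap' : edgeFlowSwap (φ r) 0 l a₀ = b₀ := by
          have h' := hswap; simp only [her] at h'; exact h'
        rw [hswap', ha0, hal] at h
        rw [h, hη, hξ, Equiv.apply_symm_apply]
      have hξp : p * μ l (y l) ≤ μ 0 ξ := by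
        have h := hdom r ξ; rw [hr] at h; rwa [hξ, ← hl, Equiv.apply_symm_apply] at h
      have hηp : p * μ l (x l) ≤ μ 0 η := by
        have h := hdom r η; rw [hr] at h; rwa [hη, ← hl, Equiv.apply_symm_apply] at h
      have hmin : p * μ l (y l) * W ≤ min (tensorFun μ a₀) (tensorFun μ b₀) := by
        refine le_min ?_ ?_
        · rw [ha]; exact mul_le_mul_of_nonneg_right hξp hWpos.le
        · -- from `hb`: `π̃(b₀)·μ_0(ξ)·μ_l(x_l) = μ_0(ξ)·W·μ_0(η)·μ_l(y_l) ≥ μ_0(ξ)·W·p·μ_l(x_l)·μ_l(y_l)`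
          have hpos : 0 < μ 0 ξ * μ l (x l) := mul_pos (hμ 0 ξ) (hμ l _)
          refine le_of_mul_le_mul_right ?_ hpos
          rw [hb, ha]
          have hWξ : 0 ≤ μ 0 ξ * W := mul_nonneg (hμ 0 ξ).le hWpos.le
          nlinarith [mul_le_mul_of_nonneg_left (mul_le_mul_of_nonneg_right hηp (hμ l (y l)).le) hWξ, hμ l (y l)]
      refine le_of_mul_le_mul_left ?_ hWpos
      calc W * (p * μ l (y l)) = p * μ l (y l) * W := by ring
        _ ≤ min (tensorFun μ a₀) (tensorFun μ b₀) := hmin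
        _ = W * (μ 0 ξ * Met r a₀ b₀) := by rw [← hkey, ha]; ring
    -- the last factor
    have h3 : (1 - t) * w 0 * μ 0 (y 0) ≤ P b₀ y := by
      have hy : update b₀ 0 (y 0) = y := by rw [hb₀, update_idem, update_eq_self]
      have h := hPup b₀ (y 0); rwa [hy] at h
    -- expansion of the power and the single path
    have hexp : ((Matrix.of P) ^ (2 * (j + 1) + 1)) x y
        = ∑ b, ∑ a, ((Matrix.of P) ^ (2 * j + 1)) x a * P a b * P b y := by
      rw [show 2 * (j + 1) + 1 = 2 * j + 1 + 1 + 1 by ring, pow_succ, pow_succ, Matrix.mul_apply]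
      refine sum_congr rfl fun b _ => ?_
      rw [Matrix.mul_apply, sum_mul]
      rfl
    rw [hexp]
    have hterm : (1 - t) * w 0 * (t / m * p * ((1 - t) * w 0)) ^ (j + 1)
          * (μ 0 (y 0) * ∏ k : Fin K, (if k.val < j + 1 then μ k.succ (y k.succ) else 1))
        ≤ ((Matrix.of P) ^ (2 * j + 1)) x a₀ * P a₀ b₀ * P b₀ y := by
      rw [partProd_succ μ y hjlt]
      set Q : ℝ := ∏ k : Fin K, (if k.val < j then μ k.succ (y k.succ) else 1) with hQ
      have hQ0 : 0 ≤ Q := prod_nonneg fun k _ => by split_ifs; exacts [(hμ _ _).le, zero_le_one]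
      set D : ℝ := (1 - t) * w 0 * (t / m * p * ((1 - t) * w 0)) ^ j with hD
      have hD0 : 0 ≤ D := mul_nonneg hh (pow_nonneg (by positivity) j)
      have hA : 0 ≤ D * (μ 0 ξ * Q) := mul_nonneg hD0 (mul_nonneg (hμ 0 ξ).le hQ0)
      have hC : 0 ≤ (1 - t) * w 0 * μ 0 (y 0) := mul_nonneg hh (hμ 0 _).le
      -- rearrange the target's left side as `D·(μ_0 ξ·Q)`-free product form
      calc (1 - t) * w 0 * (t / m * p * ((1 - t) * w 0)) ^ (j + 1) * (μ 0 (y 0) * (Q * μ l (y l)))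
          = D * Q * (t / m * (p * μ l (y l))) * ((1 - t) * w 0 * μ 0 (y 0)) := by rw [hD, pow_succ]; ring
        _ ≤ D * Q * (t / m * (μ 0 ξ * Met r a₀ b₀)) * ((1 - t) * w 0 * μ 0 (y 0)) :=
          mul_le_mul_of_nonneg_right (mul_le_mul_of_nonneg_left (mul_le_mul_of_nonneg_left h2 (by positivity))
            (mul_nonneg hD0 hQ0)) hC
        _ = (D * (μ 0 ξ * Q)) * (t / m * Met r a₀ b₀) * ((1 - t) * w 0 * μ 0 (y 0)) := by ring
        _ ≤ ((Matrix.of P) ^ (2 * j + 1)) x a₀ * (t / m * Met r a₀ b₀) * ((1 - t) * w 0 * μ 0 (y 0)) :=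
          mul_le_mul_of_nonneg_right (mul_le_mul_of_nonneg_right hIH (mul_nonneg (by positivity) (hMet0 r a₀ b₀))) hC
        _ ≤ ((Matrix.of P) ^ (2 * j + 1)) x a₀ * P a₀ b₀ * ((1 - t) * w 0 * μ 0 (y 0)) :=
          mul_le_mul_of_nonneg_right (mul_le_mul_of_nonneg_left (hPMet r a₀ b₀) (hpow0 _ x a₀)) hC
        _ ≤ ((Matrix.of P) ^ (2 * j + 1)) x a₀ * P a₀ b₀ * P b₀ y :=
          mul_le_mul_of_nonneg_left h3 (mul_nonneg (hpow0 _ x a₀) (hP0 a₀ b₀))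
    refine hterm.trans ?_
    have hin : ((Matrix.of P) ^ (2 * j + 1)) x a₀ * P a₀ b₀ * P b₀ y
        ≤ ∑ a, ((Matrix.of P) ^ (2 * j + 1)) x a * P a b₀ * P b₀ y :=
      single_le_sum (f := fun a => ((Matrix.of P) ^ (2 * j + 1)) x a * P a b₀ * P b₀ y)
        (fun a _ => mul_nonneg (mul_nonneg (hpow0 _ x a) (hP0 a b₀)) (hP0 b₀ y)) (mem_univ a₀)
    exact hin.trans (single_le_sum (f := fun b => ∑ a, ((Matrix.of P) ^ (2 * j + 1)) x a * P a b * P b y)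
      (fun b _ => sum_nonneg fun a _ => mul_nonneg (mul_nonneg (hpow0 _ x a) (hP0 a b)) (hP0 b y)) (mem_univ b₀))

/-- **`P^{2K+1}(x,y) ≥ (1−t)w_0·(t·p·(1−t)w_0/m)^K · π̃(y)` FOR EVERY START** (exact hot redraws, `κ` onto, one-sided domination,
`0 ≤ t ≤ 1`, `0 ≤ p`, `w ≥ 0`, `Σw = 1`). [ours] -/
theorem dominatedStar_pow_ge_tensorFun (hm : 1 ≤ m) (hμ : ∀ k x, 0 < μ k x) (hM : ∀ k, IsRowStochastic (M k))
    (hM0 : ∀ u v, M 0 u v = μ 0 v) (hw0 : ∀ k, 0 ≤ w k) (hw1 : ∑ k, w k = 1) (ht0 : 0 ≤ t) (ht1 : t ≤ 1) (hp : 0 ≤ p)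
    (hdom : ∀ r u, p * μ (κ r).succ (φ r u) ≤ μ 0 u) (hsurj : ∀ k : Fin K, ∃ r, κ r = k) (x y : Fin (K + 1) → S) :
    (1 - t) * w 0 * (t / m * p * ((1 - t) * w 0)) ^ K * tensorFun μ y
      ≤ ((Matrix.of fun a b : Fin (K + 1) → S =>
          t * ptGraphSwap μ (fun r : Fin m => (((0 : Fin (K + 1)), (κ r).succ) : Fin (K + 1) × Fin (K + 1))) φ a b
            + (1 - t) * prodKernel w M a b) ^ (2 * K + 1)) x y := by
  have h := dominatedStar_pow_pattern_ge κ φ hm hμ hM hM0 hw0 hw1 ht0 ht1 hp hdom hsurj K le_rfl x y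
    (fun k hk => absurd hk (by have := k.isLt; omega))
  have hprod : (∏ k : Fin K, (if k.val < K then μ k.succ (y k.succ) else 1)) = ∏ k : Fin K, μ k.succ (y k.succ) :=
    prod_congr rfl fun k _ => if_pos k.isLt
  have hπ : tensorFun μ y = μ 0 (y 0) * ∏ k : Fin K, μ k.succ (y k.succ) := by
    unfold tensorFun; rw [Fin.prod_univ_succ]
  rw [hπ, ← hprod]
  exact h

/-- **THE DOEBLIN CONDITION** `(D)` at `k = 2K+1`, `c = (1−t)w_0·(t·p·(1−t)w_0/m)^K`, `q = π̃`. [ours] -/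
theorem dominatedStar_doeblinCondition (hm : 1 ≤ m) (hμ : ∀ k x, 0 < μ k x) (hμ1 : ∀ k, ∑ u, μ k u = 1)
    (hM : ∀ k, IsRowStochastic (M k)) (hM0 : ∀ u v, M 0 u v = μ 0 v) (hw0 : ∀ k, 0 ≤ w k) (hw1 : ∑ k, w k = 1)
    (ht0 : 0 ≤ t) (ht1 : t ≤ 1) (hp : 0 ≤ p) (hdom : ∀ r u, p * μ (κ r).succ (φ r u) ≤ μ 0 u)
    (hsurj : ∀ k : Fin K, ∃ r, κ r = k) :
    DoeblinCondition (Matrix.of fun a b : Fin (K + 1) → S =>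
        t * ptGraphSwap μ (fun r : Fin m => (((0 : Fin (K + 1)), (κ r).succ) : Fin (K + 1) × Fin (K + 1))) φ a b
          + (1 - t) * prodKernel w M a b) (2 * K + 1) ((1 - t) * w 0 * (t / m * p * ((1 - t) * w 0)) ^ K) (tensorFun μ) :=
  ⟨fun z => (tensorFun_pos hμ z).le, sum_tensorFun_eq_one μ hμ1,
    fun x y => dominatedStar_pow_ge_tensorFun κ φ hm hμ hM hM0 hw0 hw1 ht0 ht1 hp hdom hsurj x y⟩

/-- **`d(n) ≤ (1 − (1−t)w_0(t·p·(1−t)w_0/m)^K)^{⌊n/(2K+1)⌋}` — NO REGIME, NO VOLUME, EVERY `K`** (qualitative: the rate is exponentially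
small in `K`). [ours] -/
theorem dominatedStar_worstTvDist_le_volumeFree [Nonempty S] (hm : 1 ≤ m) (hμ : ∀ k x, 0 < μ k x) (hμ1 : ∀ k, ∑ u, μ k u = 1)
    (hM : ∀ k, IsRowStochastic (M k)) (hMrev : ∀ k, DetailedBalance (μ k) (M k)) (hM0 : ∀ u v, M 0 u v = μ 0 v)
    (hw0 : ∀ k, 0 ≤ w k) (hw1 : ∑ k, w k = 1) (ht0 : 0 ≤ t) (ht1 : t ≤ 1) (hp : 0 ≤ p)
    (hdom : ∀ r u, p * μ (κ r).succ (φ r u) ≤ μ 0 u) (hsurj : ∀ k : Fin K, ∃ r, κ r = k) (n : ℕ) :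
    worstTvDist (fun a b : Fin (K + 1) → S =>
        t * ptGraphSwap μ (fun r : Fin m => (((0 : Fin (K + 1)), (κ r).succ) : Fin (K + 1) × Fin (K + 1))) φ a b
          + (1 - t) * prodKernel w M a b) (tensorFun μ) n
      ≤ (1 - (1 - t) * w 0 * (t / m * p * ((1 - t) * w 0)) ^ K) ^ (n / (2 * K + 1)) := by
  set P : (Fin (K + 1) → S) → (Fin (K + 1) → S) → ℝ := fun a b =>
    t * ptGraphSwap μ (fun r : Fin m => (((0 : Fin (K + 1)), (κ r).succ) : Fin (K + 1) × Fin (K + 1))) φ a b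
      + (1 - t) * prodKernel w M a b with hPdef
  have hPst : IsRowStochastic P :=
    weightedScheme_isRowStochastic (ptGraphSwap_isRowStochastic hμ) hM hw0 hw1 ht0 ht1
  have hst : IsStationary (tensorFun μ) P :=
    (weightedScheme_detailedBalance (ptGraphSwap_detailedBalance hμ) hMrev t).isStationary hPst.2
  have hD := dominatedStar_doeblinCondition κ φ hm hμ hμ1 hM hM0 hw0 hw1 ht0 ht1 hp hdom hsurj
  have hvec : tensorFun μ ᵥ* Matrix.of P = tensorFun μ := funext fun j => hst j
  refine ciSup_le fun x => ?_
  have hrow : lawAt P (Pi.single x 1) n = fun j => ((Matrix.of P) ^ n) x j :=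
    funext fun j => kernelAt_eq_pow_apply (Matrix.of P) n x j
  rw [hrow]
  exact Saloffcoste1997_thm_1_2_7_tvDist (M := Matrix.of P) hPst hD (fun z => (tensorFun_pos hμ z).le)
    (sum_tensorFun_eq_one μ hμ1) hvec x n

/-- **`t_mix(ε) ≤ (2K+1)·⌈log(1/ε)/((1−t)w_0(t·p·(1−t)w_0/m)^K)⌉` — NO REGIME, NO VOLUME, EVERY `K`** (`0 < t < 1`, `w_0 > 0`, `0 < p`,
`0 < ε`; qualitative). [ours] -/
theorem dominatedStar_mixingTime_le_volumeFree [Nonempty S] (hm : 1 ≤ m) (hμ : ∀ k x, 0 < μ k x) (hμ1 : ∀ k, ∑ u, μ k u = 1)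
    (hM : ∀ k, IsRowStochastic (M k)) (hMrev : ∀ k, DetailedBalance (μ k) (M k)) (hM0 : ∀ u v, M 0 u v = μ 0 v)
    (hw0 : ∀ k, 0 ≤ w k) (hw1 : ∑ k, w k = 1) (hwhot : 0 < w 0) (ht0 : 0 < t) (ht1 : t < 1) (hp : 0 < p)
    (hdom : ∀ r u, p * μ (κ r).succ (φ r u) ≤ μ 0 u) (hsurj : ∀ k : Fin K, ∃ r, κ r = k) {ε : ℝ} (hε : 0 < ε) :
    mixingTime (fun a b : Fin (K + 1) → S =>
        t * ptGraphSwap μ (fun r : Fin m => (((0 : Fin (K + 1)), (κ r).succ) : Fin (K + 1) × Fin (K + 1))) φ a b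
          + (1 - t) * prodKernel w M a b) (tensorFun μ) ε
      ≤ (2 * K + 1) * ⌈Real.log (1 / ε) / ((1 - t) * w 0 * (t / m * p * ((1 - t) * w 0)) ^ K)⌉₊ := by
  have hmpos : (0 : ℝ) < m := Nat.cast_pos.mpr (by omega)
  have h1t : 0 < 1 - t := by linarith
  set δ : ℝ := (1 - t) * w 0 * (t / m * p * ((1 - t) * w 0)) ^ K with hδ
  have hδ0 : 0 < δ := by positivity
  have hδ1 : δ ≤ 1 := (dominatedStar_doeblinCondition κ φ hm hμ hμ1 hM hM0 hw0 hw1 ht0.le ht1.le hp.le hdom hsurj).c_le_one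
    (weightedScheme_isRowStochastic (ptGraphSwap_isRowStochastic hμ) hM hw0 hw1 ht0.le ht1.le)
  set J : ℕ := ⌈Real.log (1 / ε) / δ⌉₊ with hJ
  refine mixingTime_le _ _ ((dominatedStar_worstTvDist_le_volumeFree κ φ hm hμ hμ1 hM hMrev hM0 hw0 hw1 ht0.le ht1.le hp.le
    hdom hsurj ((2 * K + 1) * J)).trans ?_)
  rw [Nat.mul_div_cancel_left J (by omega : 0 < 2 * K + 1)]
  have hJge : Real.log (1 / ε) / δ ≤ (J : ℝ) := Nat.le_ceil _
  have hδJ : Real.log (1 / ε) ≤ δ * J := by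
    have := mul_le_mul_of_nonneg_left hJge hδ0.le
    rwa [mul_div_cancel₀ _ hδ0.ne'] at this
  calc (1 - δ) ^ J ≤ Real.exp (-δ) ^ J :=
        pow_le_pow_left₀ (by linarith) (by have := Real.one_sub_le_exp_neg δ; linarith) J
    _ = Real.exp (-(δ * J)) := by rw [← Real.exp_nat_mul]; ring_nf
    _ ≤ Real.exp (-Real.log (1 / ε)) := Real.exp_le_exp.mpr (by linarith)
    _ = ε := by rw [one_div, Real.log_inv, neg_neg, Real.exp_log hε]

end Star

end Summit.Ventures.LatticeQCDFlow.Scaling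

end
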